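import Summits.BirchSwinnertonDyer.BirchSwinnertonDyer.Theorems.CyclotomicUntwistPSLocalThreeStableLineStar
import Summits.BirchSwinnertonDyer.BirchSwinnertonDyer.Theorems.CyclotomicUntwistPSWildThreeShapeLawRowFour
import HarnessLib

/-!
# The Kodaira-`II*` rows (`v₃Δ_min = 12`) are a ONE-STABLE-LINE locus at `3` (ORD-side: ORDM iff
# `c₆(W_ℤ)/3⁸ ≡ 1 (mod 3)`, ORD1 iff `≡ 2`) — so ALL FOUR principal-series rows carry exactly one stable line

Cell `pub/bsd-wall` (D-0145 line `route-BirchSwinnertonDyer-CyclotomicUntwist`), seat `bsd-line-cycu-p2`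
(prover seat 2/3, gen 3), helper toward K1 `PSRankOneLowerHalfAtThree` (stmt-BirchSwinnertonDyer-21580) and
K2 `PSRankOneUpperHalfAtThree` (stmt-21581): the local residual shape `W[3]|G_{ℚ₃}` on the principal-series
rows (o6-r1's six shapes, `Additive/WildThreeResidualShape.lean`). THEOREMS ONLY (no definition, no named
fact, no `sorry`); BSD is not proved by this file and no crux is.

CAPSTONE (`exists_isUniqueStableLineThree_of_psRow`, `numStableLinesAtThree_eq_one_of_psRow`): every
elliptic, globally minimal `W/ℚ` on the cyclic wild cell at `3` (`ClassO6 W 3`, `v₃Δ_min` even) has EXACTLY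
ONE `G_{ℚ₃}`-stable line in `W[3]` (census column `nroots = 1`), and its six-shape is read off Kraus's
invariants: rows `II`/`IV` (`v ≤ 6`) ET-side, ET1 iff `c₆/3^{v₃c₆} ≡ 1 (mod 3)` (`…ShapeLawRowFour.lean`);
rows `IV*`/`II*` (`v ≥ 10`) ORD-side, ORDM iff `c₆/3^{v₃c₆} ≡ 1 (mod 3)` (`shapeORDMThree_iff_of_psRow_of_ten_le`).

## Method (`II*`, `v(Δ) = 12`, `π = 3`)
On Tate's Step-10 normal form over `K_v` (`b₂ = π²β₂`, `b₄ = π⁴β₄`, `b₆ = π⁵β₆`, `β₆` a unit, `Δ = π¹²δ`):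
`w b₂ ≤ e⁻³`, `w b₈ ≤ e⁻⁸` (`map_b₂_b₈_of_shapeIIstar_twelve`), so `Ψ₃(πr)/π⁵ = r⁴ + c₃r³ + c₂r² + c₁r + c₀`
with `w c₃ ≤ e⁻¹`, `w c₂ ≤ e⁻²`, `w c₁ = e⁻²` (`c₁ = b₆/π³`), `w c₀ ≤ e⁻³`; every root has `w r ≤ e⁻¹`
(`map_lt_one_of_root_of_lt_one`), and for two roots `r ≠ s` the difference quotient
`(r³ + r²s + rs² + s³) + c₃(r² + rs + s²) + c₂(r + s) + c₁` would vanish although `c₁` dominates it strictly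
(§1 `root_eq_root_of_smallCoeffs`; the other three roots have valuation `2/3`). Existence of a `ℚ₃`-root:
`exists_isRoot_Ψ₃_padic_of_le` (`v₃c₆ = 8`, `v₃c₄ ≥ 5`: `16 ≤ 16`).
References: J. H. Silverman, *Advanced Topics* (1994), IV.9.4 Step 10 [SilvermanATAEC1994]; J.-P. Serre,
Invent. Math. 15 (1972), §1.11 [Serre1972]; A. Kraus, Manuscripta Math. 69 (1990), Théorème (p = 3) [Kraus1990].
-/

set_option autoImplicit false
-- single-conjunct summit: `Summit.BirchSwinnertonDyer.BirchSwinnertonDyer.…` repeats the name by design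
set_option linter.dupNamespace false

noncomputable section

open scoped Classical

open Polynomial WeierstrassCurve IsDedekindDomain IsDedekindDomain.HeightOneSpectrum WithZero
  Rat.HeightOneSpectrum Literature.NumberTheory.EllipticCurves
  Literature.NumberTheory.EllipticCurves.Rank1Residual Literature.NumberTheory.DiophantineGeometry
  Summit.BirchSwinnertonDyer.Rank1Residual.Additive Summit.BirchSwinnertonDyer.Rank1Residual.O5
  Summit.BirchSwinnertonDyer.Rank1Residual.O5.NonSplitAtThree
  Summit.BirchSwinnertonDyer.Rank1Residual.Additive.PsiThreeAdic
  Summit.BirchSwinnertonDyer.Rank1Residual.GaloisImage.LocalTorsion3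

open Summit.BirchSwinnertonDyer.Rank1Residual.Additive.ThreeAdicLift (le_exp_sub_one_of_lt_exp)

namespace Summit.BirchSwinnertonDyer.BirchSwinnertonDyer.Theorems.PSLocalThreeTorsion

/-! ## §1 Valued-field algebra: a monic quartic dominated by its linear coefficient has ≤ 1 small root -/

section Valued

variable {F : Type*} [Field F] (w : Valuation F ℤᵐ⁰)

/-- **At most one root in `ϖ𝒪`.** For `r⁴ + c₃r³ + c₂r² + c₁r + c₀` with `w c₃ ≤ e⁻¹`, `w c₂ ≤ e⁻²`,
`w c₁ = e⁻²`: two roots `r, s` with `w r, w s ≤ e⁻¹` coincide — the difference quotient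
`(r³ + r²s + rs² + s³) + c₃(r² + rs + s²) + c₂(r + s) + c₁` has valuation `w c₁ = e⁻²` (the other summands
are `≤ e⁻³`), so it is non-zero. [folklore] -/
theorem root_eq_root_of_smallCoeffs {c₃ c₂ c₁ c₀ r s : F} (h₃ : w c₃ ≤ exp (-1 : ℤ))
    (h₂ : w c₂ ≤ exp (-2 : ℤ)) (h₁ : w c₁ = exp (-2 : ℤ)) (hr1 : w r ≤ exp (-1 : ℤ))
    (hs1 : w s ≤ exp (-1 : ℤ)) (hr : r ^ 4 + c₃ * r ^ 3 + c₂ * r ^ 2 + c₁ * r + c₀ = 0)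
    (hs : s ^ 4 + c₃ * s ^ 3 + c₂ * s ^ 2 + c₁ * s + c₀ = 0) : r = s := by
  by_contra hne
  have hrs : r - s ≠ 0 := sub_ne_zero.mpr hne
  have hq : (r ^ 3 + r ^ 2 * s + r * s ^ 2 + s ^ 3) + c₃ * (r ^ 2 + r * s + s ^ 2) + c₂ * (r + s) + c₁ = 0 := by
    have h : (r - s) * ((r ^ 3 + r ^ 2 * s + r * s ^ 2 + s ^ 3) + c₃ * (r ^ 2 + r * s + s ^ 2) +
        c₂ * (r + s) + c₁) = (r ^ 4 + c₃ * r ^ 3 + c₂ * r ^ 2 + c₁ * r + c₀) -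
          (s ^ 4 + c₃ * s ^ 3 + c₂ * s ^ 2 + c₁ * s + c₀) := by ring
    rw [hr, hs, sub_zero, mul_eq_zero] at h
    exact h.resolve_left hrs
  -- monomial bounds
  have m2 : ∀ {x y : F}, w x ≤ exp (-1 : ℤ) → w y ≤ exp (-1 : ℤ) → w (x * y) ≤ exp (-2 : ℤ) := by
    intro x y hx hy
    calc w (x * y) ≤ exp (-1 + -1 : ℤ) := map_mul_le_exp_add w hx hy
      _ = exp (-2 : ℤ) := by norm_num
  have m3 : ∀ {x y z : F}, w x ≤ exp (-1 : ℤ) → w y ≤ exp (-1 : ℤ) → w z ≤ exp (-1 : ℤ) →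
      w (x * y * z) ≤ exp (-3 : ℤ) := by
    intro x y z hx hy hz
    calc w (x * y * z) ≤ exp (-2 + -1 : ℤ) := map_mul_le_exp_add w (m2 hx hy) hz
      _ = exp (-3 : ℤ) := by norm_num
  have hA : w (r ^ 3 + r ^ 2 * s + r * s ^ 2 + s ^ 3) ≤ exp (-3 : ℤ) := by
    rw [show r ^ 3 + r ^ 2 * s + r * s ^ 2 + s ^ 3 = r * r * r + r * r * s + r * s * s + s * s * s by ring]
    exact Valuation.map_add_le w (Valuation.map_add_le w (Valuation.map_add_le w (m3 hr1 hr1 hr1)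
      (m3 hr1 hr1 hs1)) (m3 hr1 hs1 hs1)) (m3 hs1 hs1 hs1)
  have hB : w (c₃ * (r ^ 2 + r * s + s ^ 2)) ≤ exp (-3 : ℤ) := by
    have h : w (r ^ 2 + r * s + s ^ 2) ≤ exp (-2 : ℤ) := by
      rw [show r ^ 2 + r * s + s ^ 2 = r * r + r * s + s * s by ring]
      exact Valuation.map_add_le w (Valuation.map_add_le w (m2 hr1 hr1) (m2 hr1 hs1)) (m2 hs1 hs1)
    calc w (c₃ * (r ^ 2 + r * s + s ^ 2)) ≤ exp (-1 + -2 : ℤ) := map_mul_le_exp_add w h₃ h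
      _ = exp (-3 : ℤ) := by norm_num
  have hC : w (c₂ * (r + s)) ≤ exp (-3 : ℤ) := by
    calc w (c₂ * (r + s)) ≤ exp (-2 + -1 : ℤ) := map_mul_le_exp_add w h₂ (Valuation.map_add_le w hr1 hs1)
      _ = exp (-3 : ℤ) := by norm_num
  have hlt : w ((r ^ 3 + r ^ 2 * s + r * s ^ 2 + s ^ 3) + c₃ * (r ^ 2 + r * s + s ^ 2) + c₂ * (r + s)) <
      w c₁ := by
    rw [h₁]
    exact lt_of_le_of_lt (Valuation.map_add_le w (Valuation.map_add_le w hA hB) hC)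
      (by rw [exp_lt_exp]; norm_num)
  have hval := Valuation.map_add_eq_of_lt_right w hlt
  rw [hq, map_zero, h₁] at hval
  exact exp_ne_zero hval.symm

end Valued

/-! ## §2 Over the completion `K_v`: `Ψ₃` has at most one root on the type-`II*` shape with `v(Δ) = 12` -/

section Completion

variable {A : Type*} [CommRing A] [IsDedekindDomain A] {K : Type*} [Field K] [Algebra A K]
  [IsFractionRing A K] (v : HeightOneSpectrum A)

/-- **Type `II*` with `v(Δ) = 12`: `Ψ₃` has at most one root in `K_v`.** On a `K_v`-model with
`b₂ = π²β₂`, `b₄ = π⁴β₄`, `b₆ = π⁵β₆` (`β₆` a unit), `Δ = π¹²δ` (`δ` a unit), `π = 3`: `Ψ₃(πr)/π⁵` is the monic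
quartic of §1 in `r = z/π` (`c₁ = b₆/π³` of valuation exactly `e⁻²`), every root has `w r ≤ e⁻¹`, so two roots
coincide. [cite: SilvermanATAEC1994, IV.9.4 Step 10 (normal form of type II*)] -/
theorem Ψ₃_root_unique_of_shapeIIstar_twelve {π : K} (hπ : v.valuation K π = exp (-1 : ℤ))
    (h3 : (π : v.adicCompletion K) = 3) (N : WeierstrassCurve (v.adicCompletion K))
    (β₂ β₄ β₆ δ : v.adicCompletionIntegers K) (hβ₆ : IsUnit β₆) (hδ : IsUnit δ)
    (hb₂ : N.b₂ = (π : v.adicCompletion K) ^ 2 * β₂)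
    (hb₄ : N.b₄ = (π : v.adicCompletion K) ^ 4 * β₄)
    (hb₆ : N.b₆ = (π : v.adicCompletion K) ^ 5 * β₆)
    (hΔ : N.Δ = (π : v.adicCompletion K) ^ 12 * δ) (z z' : v.adicCompletion K)
    (hz : N.Ψ₃.eval z = 0) (hz' : N.Ψ₃.eval z' = 0) : z = z' := by
  set w : Valuation (v.adicCompletion K) ℤᵐ⁰ := Valued.v with hw
  set ϖ : v.adicCompletion K := (π : v.adicCompletion K) with hϖ
  have hπv : w ϖ = exp (-1 : ℤ) := by rw [hw, hϖ, valuedAdicCompletion_eq_valuation', hπ]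
  have hϖ0 : ϖ ≠ 0 := by
    intro h0; rw [h0, map_zero] at hπv; exact exp_ne_zero hπv.symm
  have hint : ∀ β : v.adicCompletionIntegers K, w (β : v.adicCompletion K) ≤ 1 := fun β ↦ β.2
  have hunit : ∀ {β : v.adicCompletionIntegers K}, IsUnit β → w (β : v.adicCompletion K) = 1 :=
    fun hβ ↦ valued_coe_eq_one_of_isUnit v hβ
  have h3' : (3 : v.adicCompletion K) = ϖ := h3.symm
  have hpowle : ∀ (n : ℕ) (β : v.adicCompletionIntegers K),
      w (ϖ ^ n * (β : v.adicCompletion K)) ≤ exp (-(n : ℤ)) := by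
    intro n β
    rw [map_mul, map_pow, hπv, ← exp_nsmul]
    calc exp (n • (-1 : ℤ)) * w (β : v.adicCompletion K) ≤ exp (n • (-1 : ℤ)) * 1 :=
        mul_le_mul' le_rfl (hint β)
      _ = exp (-(n : ℤ)) := by simp
  have hpoweq : ∀ (n : ℕ) {β : v.adicCompletionIntegers K}, IsUnit β →
      w (ϖ ^ n * (β : v.adicCompletion K)) = exp (-(n : ℤ)) := by
    intro n β hβ
    rw [map_mul, map_pow, hπv, ← exp_nsmul, hunit hβ, mul_one]; simp
  have wb₂ : w N.b₂ ≤ exp (-2 : ℤ) := by rw [hb₂]; exact hpowle 2 β₂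
  have wb₄ : w N.b₄ ≤ exp (-4 : ℤ) := by rw [hb₄]; exact hpowle 4 β₄
  have wb₆ : w N.b₆ = exp (-5 : ℤ) := by rw [hb₆]; exact hpoweq 5 hβ₆
  have wΔ : w (-N.b₂ ^ 2 * N.b₈ - 8 * N.b₄ ^ 3 - 27 * N.b₆ ^ 2 + 9 * N.b₂ * N.b₄ * N.b₆) =
      exp (-12 : ℤ) := by
    rw [show -N.b₂ ^ 2 * N.b₈ - 8 * N.b₄ ^ 3 - 27 * N.b₆ ^ 2 + 9 * N.b₂ * N.b₄ * N.b₆ = N.Δ from rfl,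
      hΔ]
    exact hpoweq 12 hδ
  obtain ⟨wb₂', wb₈⟩ := map_b₂_b₈_of_shapeIIstar_twelve w h3' hπv wb₂ wb₄ wb₆ N.b_relation wΔ
  have wdivid : ∀ (x : v.adicCompletion K) (n : ℕ), w (x / ϖ ^ n) = w x * exp (n : ℤ) := by
    intro x n
    rw [map_div₀, map_pow, hπv, ← exp_nsmul, div_eq_mul_inv, ← exp_neg]
    congr 2
    simp
  have wdiv : ∀ (x : v.adicCompletion K) (n : ℕ) (a b : ℤ), a + n = b → w x ≤ exp a →
      w (x / ϖ ^ n) ≤ exp b := by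
    intro x n a b hab hx
    rw [wdivid, ← hab, exp_add]
    exact mul_le_mul' hx le_rfl
  have hneg1 : exp (-1 : ℤ) < (1 : ℤᵐ⁰) := by rw [← exp_zero, exp_lt_exp]; norm_num
  -- the rescaled coefficients
  have wc₃ : w (N.b₂ / ϖ ^ 2) ≤ exp (-1 : ℤ) := wdiv N.b₂ 2 (-3) (-1) (by norm_num) wb₂'
  have wc₂ : w (N.b₄ / ϖ ^ 2) ≤ exp (-2 : ℤ) := wdiv N.b₄ 2 (-4) (-2) (by norm_num) wb₄
  have wc₁ : w (N.b₆ / ϖ ^ 3) = exp (-2 : ℤ) := by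
    rw [wdivid, wb₆, ← exp_add]; norm_num
  have wc₀ : w (N.b₈ / ϖ ^ 5) ≤ exp (-3 : ℤ) := wdiv N.b₈ 5 (-8) (-3) (by norm_num) wb₈
  -- every root `y` gives a small root `y/ϖ` of the rescaled monic quartic
  have hresc : ∀ y : v.adicCompletion K, N.Ψ₃.eval y = 0 →
      (y / ϖ) ^ 4 + N.b₂ / ϖ ^ 2 * (y / ϖ) ^ 3 + N.b₄ / ϖ ^ 2 * (y / ϖ) ^ 2 +
        N.b₆ / ϖ ^ 3 * (y / ϖ) + N.b₈ / ϖ ^ 5 = 0 := by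
    intro y hy
    rw [WeierstrassCurve.eval_Ψ₃_eq] at hy
    have h : (y / ϖ) ^ 4 + N.b₂ / ϖ ^ 2 * (y / ϖ) ^ 3 + N.b₄ / ϖ ^ 2 * (y / ϖ) ^ 2 +
        N.b₆ / ϖ ^ 3 * (y / ϖ) + N.b₈ / ϖ ^ 5 =
        (3 * y ^ 4 + N.b₂ * y ^ 3 + 3 * N.b₄ * y ^ 2 + 3 * N.b₆ * y + N.b₈) / ϖ ^ 5 := by
      rw [h3']
      field_simp
    rw [h, hy, zero_div]
  have hsmall : ∀ y : v.adicCompletion K, N.Ψ₃.eval y = 0 → w (y / ϖ) ≤ exp (-1 : ℤ) := by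
    intro y hy
    have hlt : w (y / ϖ) < 1 :=
      map_lt_one_of_root_of_lt_one w (lt_of_le_of_lt wc₃ hneg1)
        (lt_of_le_of_lt wc₂ (by rw [← exp_zero, exp_lt_exp]; norm_num))
        (by rw [wc₁, ← exp_zero, exp_lt_exp]; norm_num)
        (lt_of_le_of_lt wc₀ (by rw [← exp_zero, exp_lt_exp]; norm_num)) (hresc y hy)
    have := le_exp_sub_one_of_lt_exp (n := 0) (by rwa [exp_zero])
    rwa [show (0 : ℤ) - 1 = -1 by norm_num] at this
  have heq : z / ϖ = z' / ϖ :=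
    root_eq_root_of_smallCoeffs w wc₃ wc₂ wc₁ (hsmall z hz) (hsmall z' hz') (hresc z hz) (hresc z' hz')
  have := congrArg (· * ϖ) heq
  simpa [div_mul_cancel₀ _ hϖ0] using this

end Completion

/-! ## §3 Curves over `ℚ`: the Kodaira-`II*` rows (`v₃Δ_min = 12`), and the PS-row capstone -/

section Curves

variable (W : WeierstrassCurve ℚ) [W.IsElliptic]

/-- **Kodaira `II*` at `3` with `ord₃ Δ_min = 12` ⟹ `Ψ₃` has at most one root in `ℚ₃`** (Tate's Step-10
normal form over `K_v` feeds §2; transport along `Padic.adicCompletionEquiv`).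
[cite: SilvermanATAEC1994, IV.9.4 Step 10 and Table 4.1] -/
theorem Ψ₃_root_unique_padic_of_kodairaIIstar
    (hT : W.kodairaSymbolAt (placeOf 3) = .IIstar) (hord : W.ordMinimalDiscriminant (placeOf 3) = 12)
    (r s : ℚ_[3]) (hr : ((W.baseChange ℚ_[3]).Ψ₃).IsRoot r) (hs : ((W.baseChange ℚ_[3]).Ψ₃).IsRoot s) :
    r = s := by
  haveI : PerfectField (IsLocalRing.ResidueField ((placeOf 3).adicCompletionIntegers ℚ)) :=
    PerfectField.ofFinite
  have h2 : ringChar (ℤ ⧸ (placeOf 3).asIdeal) ≠ 2 := by rw [ringChar_int_quot_placeOf 3]; decide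
  have hgen : natGenerator (placeOf 3) = 3 :=
    Literature.NumberTheory.EllipticCurves.Rat.natGenerator_primesEquiv_symm ⟨3, Nat.prime_three⟩
  have hπ : (placeOf 3).valuation ℚ (3 : ℚ) = exp (-1 : ℤ) := by
    have h := valuation_natGenerator_int (placeOf 3)
    rwa [hgen, Nat.cast_ofNat] at h
  have h3 : algebraMap ℚ ((placeOf 3).adicCompletion ℚ) 3 = 3 := map_ofNat _ 3
  obtain ⟨C, β₂, β₄, β₆, δ, hβ₆, hδ, hb₂, hb₄, hb₆, hΔ⟩ :=
    W.exists_variableChange_b_of_kodairaSymbolAt_wild (placeOf 3) h2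
      (Or.inr (Or.inr (Or.inr ⟨hT, rfl, rfl, rfl⟩))) hπ
  rw [hord] at hΔ
  set Kv := (placeOf 3).adicCompletion ℚ
  let e : ℚ_[3] ≃ₐ[ℚ] Kv := (Padic.adicCompletionEquiv ℤ ⟨3, Nat.prime_three⟩).toAlgEquiv
  have he : ∀ c : ℚ_[3], ((W.baseChange ℚ_[3]).Ψ₃).IsRoot c → (W.baseChange Kv).Ψ₃.eval (e c) = 0 := by
    intro c hc
    rw [IsRoot.def, WeierstrassCurve.baseChange, map_Ψ₃, eval_map, ← aeval_def] at hc
    rw [WeierstrassCurve.baseChange, map_Ψ₃, eval_map, ← aeval_def, aeval_algHom_apply, hc, map_zero]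
  exact e.injective (Ψ₃_root_unique_of_variableChange _ C
    (Ψ₃_root_unique_of_shapeIIstar_twelve (placeOf 3) hπ h3 _ β₂ β₄ β₆ δ hβ₆ hδ hb₂ hb₄ hb₆ hΔ)
    (e r) (e s) (he r hr) (he s hs))

variable [W.IsGloballyMinimal]

/-- `c₄ ≠ 0`, `c₆ ≠ 0`, `v₃ c₆ = 8` and `v₃ c₄ ≥ 5` on the Kodaira-`II*` rows with `v₃Δ_min = 12`
(`c₄³ = c₆² + 1728Δ`: valuations `16` and `15` on the right). [cite: Kraus1990, Théorème (p = 3)] -/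
theorem c₄_c₆_of_kodairaIIstar (hK : W.kodairaSymbolAt (placeOf 3) = .IIstar)
    (hv : padicValInt 3 W.minimalDiscriminantInt = 12) :
    W.c₄ ≠ 0 ∧ W.c₆ ≠ 0 ∧ padicValRat 3 W.c₆ = 8 ∧ 5 ≤ padicValRat 3 W.c₄ := by
  have h5 := PSTamagawaThree.padicValInt_c₆_eq_eight_of_kodairaIIstar W hK hv
  have hv6 : padicValRat 3 W.c₆ = 8 := by
    rw [← cast_integralModelInt_c₆, padicValRat.of_int]; exact_mod_cast h5
  have h₆ : W.c₆ ≠ 0 := by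
    intro h0
    have hz : (integralModelInt W).c₆ = 0 := by
      have := cast_integralModelInt_c₆ W
      rw [h0] at this
      exact_mod_cast this
    rw [hz] at h5
    simp at h5
  have hΔ : W.Δ ≠ 0 := W.coe_Δ' ▸ W.Δ'.ne_zero
  have hvΔ : padicValRat 3 W.Δ = 12 := by
    rw [← cast_minimalDiscriminantInt, padicValRat.of_int]; exact_mod_cast hv
  have h1728 : padicValRat 3 (1728 : ℚ) = 3 := by
    have h := padicValRat_three_pow_mul 3 64 (by norm_num)
    norm_num at h
    exact_mod_cast h
  have hrel : W.c₄ ^ 3 = W.c₆ ^ 2 + 1728 * W.Δ := by linear_combination -W.c_relation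
  have hv1 : padicValRat 3 (W.c₆ ^ 2) = 16 := by rw [padicValRat.pow, hv6]; norm_num
  have hv2 : padicValRat 3 (1728 * W.Δ) = 15 := by
    rw [padicValRat.mul (by norm_num) hΔ, h1728, hvΔ]; norm_num
  have hsum : W.c₆ ^ 2 + 1728 * W.Δ ≠ 0 := by
    intro h0
    have e : W.c₆ ^ 2 = -(1728 * W.Δ) := by linear_combination h0
    have := congrArg (padicValRat 3) e
    rw [padicValRat.neg, hv1, hv2] at this
    norm_num at this
  have h₄ : W.c₄ ≠ 0 := by
    intro h0
    rw [h0, zero_pow three_ne_zero] at hrel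
    exact hsum hrel.symm
  refine ⟨h₄, h₆, hv6, ?_⟩
  have hmin := padicValRat.min_le_padicValRat_add (p := 3) hsum
  rw [hv1, hv2, ← hrel, padicValRat.pow] at hmin
  norm_num at hmin
  omega

/-- **The Kodaira-`II*` rows (`v₃Δ_min = 12`) are a one-stable-line locus.**
[cite: SilvermanATAEC1994, IV.9.4 Step 10] [cite: Serre1972, §1.11] -/
theorem exists_isUniqueStableLineThree_of_kodairaIIstar (hK : W.kodairaSymbolAt (placeOf 3) = .IIstar)
    (hv : padicValInt 3 W.minimalDiscriminantInt = 12) : ∃ x₀, IsUniqueStableLineThree W x₀ := by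
  obtain ⟨h₄, h₆, hv6, h5⟩ := c₄_c₆_of_kodairaIIstar W hK hv
  have hord : W.ordMinimalDiscriminant (placeOf 3) = 12 := by
    rw [ordMinimalDiscriminant_placeOf_eq W 3, hv]
  obtain ⟨x, hx⟩ := exists_isRoot_Ψ₃_padic_of_le W h₄ h₆ (by rw [hv6]; omega)
  exact ⟨x, hx, fun r hr ↦ Ψ₃_root_unique_padic_of_kodairaIIstar W hK hord r x hr hx⟩

/-- **CAPSTONE: every principal-series row carries exactly one stable line** (`ClassO6 W 3`, `v₃Δ_min`
even: rows `II`, `IV`, `IV*`, `II*`). [cite: Serre1972, §1.11] [cite: Kraus1990, Théorème (p = 3)] -/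
theorem exists_isUniqueStableLineThree_of_psRow (hO6 : ClassO6 W 3)
    (hev : Even (padicValInt 3 W.minimalDiscriminantInt)) : ∃ x₀, IsUniqueStableLineThree W x₀ := by
  obtain ⟨-, hadd, hW⟩ := hO6
  rcases PSKodairaDictionary.kodairaSymbolAt_of_even W hadd hW hev with
    ⟨hK, h⟩ | ⟨hK, h⟩ | ⟨hK, h⟩ | ⟨hK, h⟩
  · exact exists_isUniqueStableLineThree_of_kodairaII W hK h
  · exact exists_isUniqueStableLineThree_of_kodairaIV W hK h
  · exact exists_isUniqueStableLineThree_of_kodairaIVstar W hK h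
  · exact exists_isUniqueStableLineThree_of_kodairaIIstar W hK h

/-- The census column: `numStableLinesAtThree W = 1` on every principal-series row. [folklore] -/
theorem numStableLinesAtThree_eq_one_of_psRow (hO6 : ClassO6 W 3)
    (hev : Even (padicValInt 3 W.minimalDiscriminantInt)) : numStableLinesAtThree W = 1 :=
  (numStableLinesAtThree_eq_one_iff W).mpr (exists_isUniqueStableLineThree_of_psRow W hO6 hev)

/-- **The ORD rows read in Kraus currency**: on the principal-series rows with `v₃Δ_min ≥ 10` (`IV*`, `II*`;
`v₃c₆ ∈ {6, 8}` even) the shape is ORD-side, and ORDM iff `c₆(W_ℤ)/3^{v₃c₆} % 3 = 1` (else ORD1, the line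
`≅ μ₃`). [cite: Serre1972, §1.11] [cite: Serre1973, Ch. II §3.3] -/
theorem shapeORDMThree_iff_of_psRow_of_ten_le (hO6 : ClassO6 W 3)
    (hev : Even (padicValInt 3 W.minimalDiscriminantInt)) (h10 : 10 ≤ padicValInt 3 W.minimalDiscriminantInt) :
    ShapeOrdSideThree W ∧
      (ShapeORDMThree W ↔
        (integralModelInt W).c₆ / 3 ^ padicValInt 3 (integralModelInt W).c₆ % 3 = 1) := by
  have h1 := exists_isUniqueStableLineThree_of_psRow W hO6 hev
  have hord : ShapeOrdSideThree W := ((shapeOrdSideThree_iff_of_psRow W hO6 hev h1).1).mpr h10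
  refine ⟨hord, ?_⟩
  -- `v₃c₆ = 2k` with `k ∈ {3, 4}`
  obtain ⟨k, hk, hk'⟩ : ∃ k : ℕ, padicValInt 3 (integralModelInt W).c₆ = 2 * k ∧ (k = 3 ∨ k = 4) := by
    rcases PSTamagawaThree.padicValInt_c₆_of_classO6_of_even W hO6 hev with
      ⟨h, h'⟩ | ⟨h, h'⟩ | ⟨h, h'⟩ | ⟨h, h'⟩
    · omega
    · omega
    · exact ⟨3, by rw [h'], Or.inl rfl⟩
    · exact ⟨4, by rw [h'], Or.inr rfl⟩
  set n : ℤ := (integralModelInt W).c₆ with hn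
  have hc₆ : W.c₆ ≠ 0 := (stableLineSignThree_eq_c₆_mul W h1.choose_spec).1
  have hn0 : n ≠ 0 := by
    intro h0
    apply hc₆
    have := cast_integralModelInt_c₆ W
    rw [← hn, h0] at this
    exact_mod_cast this.symm
  have hvq : padicValRat 3 W.c₆ = 2 * k := by
    rw [← cast_integralModelInt_c₆, padicValRat.of_int, ← hn]; exact_mod_cast hk
  have hevc : Even (padicValRat 3 W.c₆) := ⟨k, by rw [hvq]; ring⟩
  have hc₆' : (W.c₆ : ℚ_[3]) ≠ 0 := by exact_mod_cast hc₆
  have hcast : (W.c₆ : ℚ_[3]) = ((n : ℚ) : ℚ_[3]) := by rw [hn, cast_integralModelInt_c₆]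
  have hdvd : (3 : ℤ) ^ (2 * k) ∣ n := by
    have := padicValInt_dvd (p := 3) n
    rw [hk] at this; exact_mod_cast this
  have h7 : ¬ (3 : ℤ) ^ (2 * k + 1) ∣ n := by
    intro h
    have := (padicValInt_dvd_iff (2 * k + 1) n).mp (by exact_mod_cast h)
    rw [hk] at this
    omega
  have hsq : UnitPartCongThree (W.c₆ : ℚ_[3]) 1 ↔ n / 3 ^ (2 * k) % 3 = 1 := by
    have e1 : IsSquare (W.c₆ : ℚ_[3]) ↔ UnitPartCongThree (W.c₆ : ℚ_[3]) 1 := by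
      rw [isSquare_iff_even_valuation_and_unitPartCongThree_one hc₆', Padic.valuation_ratCast, hvq]
      exact ⟨fun h ↦ h.2, fun h ↦ ⟨⟨k, by ring⟩, h⟩⟩
    rw [← e1, hcast, Rat.cast_intCast, isSquare_intCast_padic_three_iff n (2 * k) hdvd h7]
    omega
  rw [shapeORDMThree_iff W h1, hk, hsq]
  exact ⟨fun h ↦ h.2, fun h ↦ ⟨hevc, h⟩⟩

end Curves

end Summit.BirchSwinnertonDyer.BirchSwinnertonDyer.Theorems.PSLocalThreeTorsion

end
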